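import Summits.HodgeConjecture.CorCM.CMAbelianFourfoldClassification
import Summits.HodgeConjecture.CorCM.CMAlgebraDegreeLeTenFamilies
import Summits.HodgeConjecture.CorCM.BiproductSlotsDomination
import HarnessLib

/-!
# Complex abelian varieties of CM type of dimension `≤ 5`: all powers are divisor-generated iff no elliptic-curve
# factor's field embeds in `End⁰` of a simple threefold or fourfold factor and no simple fourfold factor is exceptional

COR-CM (cell `pub-hodgecm2`, binder seat `b16` gen 38, count-neutral claim CM5-CLASSIF, file F6; theorems only, no
definition, no named fact).  NEW as stated (an assembly of tree theorems), hence under `Summits/`.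

[MoonenZarhin1999LowDim, Thm. (0.2)] for `dim X = 5` (with Thm. (0.1) for `dim X ≤ 4`), CM case, ON THE VARIETY — the
sequel of `CorCM/CMAbelianFourfoldPowers` / `…Classification` (files F2/F3) built on the type-level criterion of file F5
(`CorCM/CMAlgebraDegreeLeTenFamilies`).  For a complex abelian variety `X` of CM type with `dim X ≤ 5` write
(a⁺) := «there are an elliptic curve `E` and a SIMPLE abelian variety `T` of dimension `3` OR `4`, both isogeny factors of
`X` (`Domination.AVDominatedBy`), with a ring embedding `End⁰(E) ↪ End⁰(T)`» — Moonen–Zarhin's cases (a), (e), (f)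
(`dim T = 3`) and (g) (`dim T = 4`) — and (b′) := «some SIMPLE abelian FOURFOLD isogeny factor `F` of `X` is not
divisor-generated» (case (b): `F` carries Weil classes).  Then:

* §1 **`exists_not_isDivisorGenerated_powSucc_of_curve_factor`** — (a⁺) ⟹ some power `X^{N+1}` carries an exotic
  Hodge class (in case (g) not `X` itself: «`B•(X) = D•(X)`» there); `not_isDivisorGenerated_of_fourfold_factor` — (b′) ⟹
  `B•(X) ≠ D•(X)`;
* §2 **`isDivisorGenerated_of_avDominatedBy_powSucc_of_isOfCMType_of_dim_le_five`** (MASTER FORM) — ¬(a⁺) ∧ ¬(b′) ⟹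
  every complex abelian variety dominated by a power of `X` is divisor-generated, and (`hodgeConjectureFor_…`) satisfies
  the Hodge conjecture, UNCONDITIONALLY (Moonen–Zarhin (0.2) (4) with Hazama–Murty, CM case);
* §3 **`forall_isDivisorGenerated_powSucc_iff_of_isOfCMType_of_dim_le_five`** — THE CLASSIFICATION:
  `(∀ N, B•(X^{N+1}) = D•(X^{N+1})) ⟺ ¬(a⁺) ∧ ¬(b′)`; `hcOnClass_…` display.  (In dimension `5`, unlike dimension `4`,
  `B•(X) = D•(X)` does NOT imply the same for the powers: case (g).)

## References

* [MoonenZarhin1999LowDim] B. Moonen, Yu. Zarhin, *Hodge classes on abelian varieties of low dimension*, Math. Ann.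
  315 (1999) 711–733, Thms. (0.1), (0.2) and §5.
* [MumfordAV1970] D. Mumford, *Abelian Varieties*, §19 Thm. 1, Cor. 1–2 (pp. 173–174).
* [Gordon1999HodgeAVSurvey] B. B. Gordon, *A survey of the Hodge conjecture for abelian varieties*, 7.5–7.6, 9.2, 10.10.
-/

noncomputable section

open CategoryTheory CategoryTheory.Limits NumberField
open scoped BigOperators

namespace Summit.HodgeConjecture.CorCM

open Literature.NumberTheory.ComplexMultiplication
open Literature.AlgebraicGeometry.Motives (AbelianVariety CMType)
open Literature.AlgebraicGeometry.Motives.AbelianVariety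
open Literature.AlgebraicGeometry.HodgeTheory
open Literature.AlgebraicGeometry.ComplexMultiplication
open Literature.AlgebraicGeometry.VanGeemen1994 (hodgeClassSpan)
open Literature.AlgebraicGeometry.Milne1999
open Literature.AlgebraicGeometry.Pohlmann1968
open Literature.Barriers.HodgeConjecture (divisorClassesSpan)
open Summit.HodgeConjecture.CorCM.Domination
open Summit.HodgeConjecture.HodgeConjecture.Ring2.ClassTargets (HCOnClass)
open Summit.HodgeConjecture.HodgeConjecture.Ring2.Atlas (nonempty_ringEquiv_endAlgebra_of_isSimple)

variable {X : AbelianVariety ℂ}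

/-! ## §1 The exceptional cases (a⁺) and (b′) -/

section Exceptional

/-- **Case (a⁺) ⟹ an exotic Hodge class on some power.**  Let `X` be of CM type with `dim X ≤ 5`, `E` an elliptic curve
and `T` a simple abelian variety of dimension `3` or `4`, both isogeny factors of `X`, with `End⁰(E) ↪ End⁰(T)`.  Then
some power `X^{N+1}` is NOT divisor-generated.  Proof: in Milne's regrouping `X ∼ ⨁ᵢ A'_{cls i}` (gen 36), `E` and `T`
are isogenous to representatives (uniqueness of simple factors), whose fields inherit the embedding (`End⁰ ≅ K`), so
the family of representatives is DEGENERATE by the criterion of file F5; Hazama–Murty produces an exotic class on some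
`⨁_j A'_{π j}`, which is an isogeny factor of a power of `X` (seat b27's `exists_avDominatedBy_biproduct_slots_powSucc`).
[cite: MoonenZarhin1999LowDim, Thm. (0.2) (e), (f), (g), (1)–(3)] [cite: Gordon1999HodgeAVSurvey, 7.5 and 9.2] -/
theorem exists_not_isDivisorGenerated_powSucc_of_curve_factor (hcm : IsOfCMType X) (h5 : X.dim ≤ 5)
    {E T : AbelianVariety ℂ} (hE : E.dim = 1) (hT : T.IsSimple) (hT34 : T.dim = 3 ∨ T.dim = 4)
    (hEX : AVDominatedBy E X) (hTX : AVDominatedBy T X) (e : E.endAlgebra →+* T.endAlgebra) :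
    ∃ N : ℕ, ¬ IsDivisorGenerated (X.powSucc N) := by
  classical
  have hX0 : 0 < X.dim := by
    obtain ⟨s, π, N, hN, hsπ⟩ := hEX
    by_contra h0
    push Not at h0
    have hπ0 : π = 0 := hom_eq_zero_of_dim_eq_zero (Or.inl (by omega)) π
    exact (ne_zero_of_comp_eq_nsmul_id hN hsπ (by omega)).2 hπ0
  obtain ⟨C, _, K', _, _, _, Φ', A', ι', θ', m, cls, f, hA, hs, hniso, hcls, hf⟩ :=
    exists_isIsogeny_biproduct_of_isSimple_of_isOfCMType (X := X) hX0 hcm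
  haveI : Nonempty C := ⟨cls 0⟩
  have hsum : ∑ c, (A' c).dim ≤ 5 := (sum_dim_le_dim_of_isIsogeny_biproduct hcls hf).trans h5
  have hXP : AVDominatedBy X (⨁ fun i => A' (cls i)) := AVDominatedBy.of_isIsogeny_hom hf (AVDominatedBy.refl _)
  -- `E ∼ A'_{cls i}`, `T ∼ A'_{cls j}`
  obtain ⟨i, hi⟩ := exists_isIsogenous_of_isSimple_of_avDominatedBy_biproduct (F := fun i => A' (cls i))
    (fun i => hs (cls i)) (isSimple_of_dim_le_one (by omega)) (by omega) (hEX.trans hXP)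
  obtain ⟨j, hj⟩ := exists_isIsogenous_of_isSimple_of_avDominatedBy_biproduct (F := fun i => A' (cls i))
    (fun i => hs (cls i)) hT (by omega) (hTX.trans hXP)
  have h1 : (A' (cls i)).dim = 1 := by obtain ⟨g, hg⟩ := hi; rw [← dim_eq_of_isIsogeny hg, hE]
  have h34 : (A' (cls j)).dim = 3 ∨ (A' (cls j)).dim = 4 := by obtain ⟨g, hg⟩ := hj; rw [← dim_eq_of_isIsogeny hg]; exact hT34
  have hij : cls i ≠ cls j := fun h => by rw [h] at h1; omega
  obtain ⟨eE⟩ := nonempty_ringEquiv_endAlgebra_of_isSimple (hA (cls i)) (hs (cls i))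
  obtain ⟨eT⟩ := nonempty_ringEquiv_endAlgebra_of_isSimple (hA (cls j)) (hs (cls j))
  obtain ⟨uE⟩ := hi.nonempty_endAlgebra_algEquiv
  obtain ⟨uT⟩ := hj.nonempty_endAlgebra_algEquiv
  let e' : K' (cls i) →+* K' (cls j) :=
    eT.symm.toRingHom.comp (uT.toRingEquiv.toRingHom.comp (e.comp (uE.symm.toRingEquiv.toRingHom.comp eE.toRingHom)))
  -- the family of representatives is degenerate
  have hdeg : ¬ CMAlgebra.IsNondegenerateFamily Φ' := fun hnd =>
    (((isNondegenerateFamily_iff_of_isSimple_of_sum_dim_le_five hA hs hniso hsum).1 hnd).1 _ _ hij h1 h34).false e'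
  obtain ⟨N, π, mm, c, hcQ, hcH, hcD⟩ := CMAlgebra.exists_exceptional_prod_of_not_isNondegenerateFamily
    (CMAlgebra.isSeparatingFamily_of_isSimple_of_pairwise_not_isIsogenous hA hs hniso) hdeg hA
  obtain ⟨M, hM⟩ := exists_avDominatedBy_biproduct_slots_powSucc hcls ⟨f, hf⟩ π
  exact ⟨M, fun hD => hcD (isDivisorGenerated_of_avDominatedBy hM hD mm c hcQ hcH)⟩

/-- **Case (a⁺) verbatim: `X ∼ E × T`** (or `X ∼ E × (T × Y)`, …: any decomposition exhibiting `E` and `T` as isogeny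
factors) with `End⁰(E) ↪ End⁰(T)`, `T` simple of dimension `3` or `4`: some power of `X` is not divisor-generated.
[cite: MoonenZarhin1999LowDim, Thm. (0.2) (e)–(g)] -/
theorem exists_not_isDivisorGenerated_powSucc_of_isIsogenous_curve_prod (hcm : IsOfCMType X) (h5 : X.dim ≤ 5)
    {E T Y : AbelianVariety ℂ} (hE : E.dim = 1) (hT : T.IsSimple) (hT34 : T.dim = 3 ∨ T.dim = 4)
    (hXETY : IsIsogenous X (E.prod (T.prod Y))) (e : E.endAlgebra →+* T.endAlgebra) :
    ∃ N : ℕ, ¬ IsDivisorGenerated (X.powSucc N) :=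
  have hPX : AVDominatedBy (E.prod (T.prod Y)) X := AVDominatedBy.of_isIsogenous hXETY.symm' (AVDominatedBy.refl X)
  exists_not_isDivisorGenerated_powSucc_of_curve_factor hcm h5 hE hT hT34
    ((SliceExhaustion.avDominatedBy_prod_left E _).trans hPX)
    (((SliceExhaustion.avDominatedBy_prod_left T Y).trans (avDominatedBy_prod_right E _)).trans hPX) e

/-- **Case (b′) ⟹ `B•(X) ≠ D•(X)`**: an isogeny factor which is not divisor-generated obstructs `B = D` on `X` (no CM
hypothesis needed). [cite: MoonenZarhin1999LowDim, Thm. (0.1) (b) and (1)] [cite: vanGeemen1994HodgeAV, §3.6–3.7] -/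
theorem not_isDivisorGenerated_of_factor {F : AbelianVariety ℂ} (hFX : AVDominatedBy F X)
    (hF : ¬ IsDivisorGenerated F) : ¬ IsDivisorGenerated X := fun hX => hF (isDivisorGenerated_of_avDominatedBy hFX hX)

end Exceptional

/-! ## §2 The good case: ¬(a⁺) ∧ ¬(b′) ⟹ all powers divisor-generated -/

section Powers

/-- **MASTER FORM — Moonen–Zarhin (0.2) (4), CM case.**  Let `X` be a complex abelian variety of CM type with
`dim X ≤ 5` such that (¬a⁺) no elliptic curve `E` and simple abelian variety `T` of dimension `3` or `4`, both isogeny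
factors of `X`, admit `End⁰(E) ↪ End⁰(T)`, and (¬b′) every simple abelian fourfold isogeny factor of `X` is
divisor-generated.  Then every complex abelian variety `B` DOMINATED by a power `X^{N+1}` is divisor-generated.  Proof:
the regrouping has total dimension `≤ 5` and satisfies the criterion of file F5 — a curve/threefold or curve/fourfold
embedding of fields would give (a⁺) with the representatives as factors (`End⁰ ≅ K`), a degenerate octic slot would be a
non-divisor-generated simple fourfold factor (octic criterion) — so `B = D` on every `⨁_j A'_{π j} ≽ X^{N+1} ≽ B`.
UNCONDITIONAL. [cite: MoonenZarhin1999LowDim, Thm. (0.2) (4)] [cite: Gordon1999HodgeAVSurvey, 7.5 and 7.6.1]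
[cite: Milne1999LefschetzClasses, §1 Prop. 1.1] -/
theorem isDivisorGenerated_of_avDominatedBy_powSucc_of_isOfCMType_of_dim_le_five {B : AbelianVariety ℂ}
    (hcm : IsOfCMType X) (h5 : X.dim ≤ 5)
    (hna : ¬ ∃ E T : AbelianVariety ℂ, E.dim = 1 ∧ T.IsSimple ∧ (T.dim = 3 ∨ T.dim = 4) ∧
      AVDominatedBy E X ∧ AVDominatedBy T X ∧ Nonempty (E.endAlgebra →+* T.endAlgebra))
    (hnb : ∀ F : AbelianVariety ℂ, F.IsSimple → F.dim = 4 → AVDominatedBy F X → IsDivisorGenerated F)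
    {N : ℕ} (hB : AVDominatedBy B (X.powSucc N)) : IsDivisorGenerated B := by
  classical
  rcases Nat.eq_zero_or_pos X.dim with h0 | hX0
  · have hdim : ∀ n : ℕ, (X.powSucc n).dim = 0 := by
      intro n
      induction n with
      | zero => exact h0
      | succ n ih => rw [powSucc_succ, dim_prod, ih, h0]
    exact isDivisorGenerated_of_avDominatedBy hB (isDivisorGenerated_of_dim_eq_zero _ (hdim N))
  obtain ⟨C, _, K', _, _, _, Φ', A', ι', θ', m, cls, f, hA, hs, hniso, hcls, hf⟩ :=
    exists_isIsogeny_biproduct_of_isSimple_of_isOfCMType (X := X) hX0 hcm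
  haveI : Nonempty C := ⟨cls 0⟩
  have hsum : ∑ c, (A' c).dim ≤ 5 := (sum_dim_le_dim_of_isIsogeny_biproduct hcls hf).trans h5
  have hXP : AVDominatedBy X (⨁ fun i => A' (cls i)) := AVDominatedBy.of_isIsogeny_hom hf (AVDominatedBy.refl _)
  have hPX : AVDominatedBy (⨁ fun i => A' (cls i)) X := AVDominatedBy.of_isIsogeny_inv hf (AVDominatedBy.refl _)
  have hslot : ∀ i, AVDominatedBy (A' (cls i)) X := fun i =>
    (avDominatedBy_biproduct_summand (fun i => A' (cls i)) i).trans hPX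
  -- (¬a⁺) on the representatives
  have hfor : ∀ a b, a ≠ b → (A' a).dim = 1 → ((A' b).dim = 3 ∨ (A' b).dim = 4) → IsEmpty (K' a →+* K' b) := by
    intro a b _ ha hb
    by_contra hne
    rw [not_isEmpty_iff] at hne
    obtain ⟨e⟩ := hne
    obtain ⟨ia, rfl⟩ := hcls a
    obtain ⟨ib, rfl⟩ := hcls b
    obtain ⟨eE⟩ := nonempty_ringEquiv_endAlgebra_of_isSimple (hA (cls ia)) (hs (cls ia))
    obtain ⟨eT⟩ := nonempty_ringEquiv_endAlgebra_of_isSimple (hA (cls ib)) (hs (cls ib))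
    exact hna ⟨A' (cls ia), A' (cls ib), ha, hs (cls ib), hb, hslot ia, hslot ib,
      ⟨eT.toRingHom.comp (e.comp eE.symm.toRingHom)⟩⟩
  -- (¬b′) on the representatives
  have hoct : ∀ b, (A' b).dim = 4 → IsNondegenerate (Φ' b) := by
    intro b hb
    obtain ⟨ib, rfl⟩ := hcls b
    obtain ⟨φ₀⟩ : Nonempty (K' (cls ib) →+* ℂ) := inferInstance
    have h8 : Module.finrank ℚ (K' (cls ib)) = 8 := by
      rw [finrank_eq_two_mul_dim_of_isCMTypeRealisation (hA (cls ib)), hb]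
    exact (isDivisorGenerated_iff_isNondegenerate_of_finrank_eq_eight h8 φ₀
      ((isSimple_iff_isPrimitive (hA (cls ib)) φ₀).1 (hs (cls ib))) (hA (cls ib))).1
      (hnb _ (hs (cls ib)) hb (hslot ib))
  obtain ⟨n, π, hdom⟩ := exists_avDominatedBy_powSucc_biproduct_slots A' cls hXP N
  refine isDivisorGenerated_of_avDominatedBy (hB.trans hdom) fun p c hcQ hcH => ?_
  rw [← hodgeClassSpan_prod_eq_divisorClassesSpan_of_sum_dim_le_five hA hs hniso hsum hfor hoct π p]
  exact Submodule.subset_span ⟨hcQ, hcH⟩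

/-- **The Hodge conjecture for everything dominated by a power of a CM abelian variety of dimension `≤ 5` outside the
cases (a⁺), (b′)**, UNCONDITIONALLY. [cite: MoonenZarhin1999LowDim, Thm. (0.2) (4)] [cite: Gordon1999HodgeAVSurvey, 10.10]
[cite: Deligne2000, §1] -/
theorem hodgeConjectureFor_of_avDominatedBy_powSucc_of_isOfCMType_of_dim_le_five {B : AbelianVariety ℂ}
    (hcm : IsOfCMType X) (h5 : X.dim ≤ 5)
    (hna : ¬ ∃ E T : AbelianVariety ℂ, E.dim = 1 ∧ T.IsSimple ∧ (T.dim = 3 ∨ T.dim = 4) ∧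
      AVDominatedBy E X ∧ AVDominatedBy T X ∧ Nonempty (E.endAlgebra →+* T.endAlgebra))
    (hnb : ∀ F : AbelianVariety ℂ, F.IsSimple → F.dim = 4 → AVDominatedBy F X → IsDivisorGenerated F)
    {N : ℕ} (hB : AVDominatedBy B (X.powSucc N)) : HodgeConjectureFor B.dim B.X :=
  hodgeConjectureFor_of_isDivisorGenerated _
    (isDivisorGenerated_of_avDominatedBy_powSucc_of_isOfCMType_of_dim_le_five hcm h5 hna hnb hB)

/-- **The Hodge conjecture for every power `X^{N+1}`** of such an `X`. [cite: MoonenZarhin1999LowDim, Thm. (0.2) (4)]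
[cite: Gordon1999HodgeAVSurvey, 10.10] -/
theorem hodgeConjectureFor_powSucc_of_isOfCMType_of_dim_le_five (hcm : IsOfCMType X) (h5 : X.dim ≤ 5)
    (hna : ¬ ∃ E T : AbelianVariety ℂ, E.dim = 1 ∧ T.IsSimple ∧ (T.dim = 3 ∨ T.dim = 4) ∧
      AVDominatedBy E X ∧ AVDominatedBy T X ∧ Nonempty (E.endAlgebra →+* T.endAlgebra))
    (hnb : ∀ F : AbelianVariety ℂ, F.IsSimple → F.dim = 4 → AVDominatedBy F X → IsDivisorGenerated F) (N : ℕ) :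
    IsDivisorGenerated (X.powSucc N) ∧ HodgeConjectureFor (X.powSucc N).dim (X.powSucc N).X :=
  ⟨isDivisorGenerated_of_avDominatedBy_powSucc_of_isOfCMType_of_dim_le_five hcm h5 hna hnb (AVDominatedBy.refl _),
    hodgeConjectureFor_of_avDominatedBy_powSucc_of_isOfCMType_of_dim_le_five hcm h5 hna hnb (AVDominatedBy.refl _)⟩

end Powers

/-! ## §3 The classification -/

section Classification

/-- **MOONEN–ZARHIN (0.2) (with (0.1)), CM CASE, ON THE VARIETY.**  For a complex abelian variety `X` of CM type with
`dim X ≤ 5`: ALL POWERS `X^{N+1}` are divisor-generated (equivalently: no power, no isogeny factor of a power, no product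
of such supports an exotic Hodge class; the Hodge conjecture holds for all of them unconditionally) iff
(¬a⁺) no elliptic curve `E` and simple abelian variety `T` of dimension `3` or `4`, both isogeny factors of `X`, admit a
ring embedding `End⁰(E) ↪ End⁰(T)` — excluding Moonen–Zarhin's (a), (e), (f), (g) — and (¬b′) every simple abelian
fourfold isogeny factor of `X` is divisor-generated — excluding (b).  [In dimension `5`, `B•(X) = D•(X)` alone does not
suffice: in case (g) `B•(X) = D•(X)` but `B•(X²) ≠ D•(X²)`.] [cite: MoonenZarhin1999LowDim, Thms. (0.1), (0.2)]
[cite: Gordon1999HodgeAVSurvey, 7.5–7.6 and 9.2] -/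
theorem forall_isDivisorGenerated_powSucc_iff_of_isOfCMType_of_dim_le_five (hcm : IsOfCMType X) (h5 : X.dim ≤ 5) :
    (∀ N : ℕ, IsDivisorGenerated (X.powSucc N)) ↔
      (¬ ∃ E T : AbelianVariety ℂ, E.dim = 1 ∧ T.IsSimple ∧ (T.dim = 3 ∨ T.dim = 4) ∧
          AVDominatedBy E X ∧ AVDominatedBy T X ∧ Nonempty (E.endAlgebra →+* T.endAlgebra)) ∧
        ∀ F : AbelianVariety ℂ, F.IsSimple → F.dim = 4 → AVDominatedBy F X → IsDivisorGenerated F := by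
  refine ⟨fun h => ⟨?_, fun F hF hF4 hFX => ?_⟩, fun h N =>
    isDivisorGenerated_of_avDominatedBy_powSucc_of_isOfCMType_of_dim_le_five hcm h5 h.1 h.2 (AVDominatedBy.refl _)⟩
  · rintro ⟨E, T, hE, hT, hT34, hEX, hTX, ⟨e⟩⟩
    obtain ⟨N, hN⟩ := exists_not_isDivisorGenerated_powSucc_of_curve_factor hcm h5 hE hT hT34 hEX hTX e
    exact hN (h N)
  · by_contra hF'
    exact not_isDivisorGenerated_of_factor hFX hF' (h 0)

/-- **Class-target display** (`Ring2.ClassTargets.HCOnClass`): the Hodge conjecture on the class of complex abelian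
varieties dominated by a power of a CM abelian variety of dimension `≤ 5` outside the cases (a⁺), (b′). UNCONDITIONAL.
[cite: MoonenZarhin1999LowDim, Thm. (0.2) (4)] [cite: Deligne2000, §1] -/
theorem hcOnClass_avDominatedBy_powSucc_isOfCMType_dim_le_five :
    HCOnClass fun B => ∃ (X : AbelianVariety ℂ) (N : ℕ), IsOfCMType X ∧ X.dim ≤ 5 ∧
      (¬ ∃ E T : AbelianVariety ℂ, E.dim = 1 ∧ T.IsSimple ∧ (T.dim = 3 ∨ T.dim = 4) ∧
          AVDominatedBy E X ∧ AVDominatedBy T X ∧ Nonempty (E.endAlgebra →+* T.endAlgebra)) ∧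
      (∀ F : AbelianVariety ℂ, F.IsSimple → F.dim = 4 → AVDominatedBy F X → IsDivisorGenerated F) ∧
      AVDominatedBy B (X.powSucc N) :=
  fun _ ⟨_, _, hcm, h5, hna, hnb, hB⟩ =>
    hodgeConjectureFor_of_avDominatedBy_powSucc_of_isOfCMType_of_dim_le_five hcm h5 hna hnb hB

end Classification

end Summit.HodgeConjecture.CorCM

end
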